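import Literature.NumberTheory.GaloisRepresentations.ContinuousCohomologyIntCoefficients
import HarnessLib

/-!
# Functoriality of the continuous Bockstein and the INDEX FORMULA for `H²(Ẑ, ℤ) ≅ ℚ/ℤ`

Topic `NumberTheory/GaloisRepresentations`; namespace `Literature.NumberTheory.GaloisRepresentations`.
Sequel of `ContinuousCohomologyBockstein.lean` / `ContinuousCohomologyIntCoefficients.lean`.

For a continuous homomorphism `θ : G' → G` of topological groups and a short exact sequence
`0 → M₁ → M₂ → M₃ → 0` of discrete `G`-modules:

* §1 `pullHom θ f`, `IsSES.pull θ h` — the pulled-back short exact sequence of `G'`-modules;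
  `pullH θ ρ n : Hⁿ(G, M) → Hⁿ(G', M|θ)` (Mathlib's `ContinuousCohomology.map` along `θ` and the
  identity of the module), `pullH_oneCocycleClass`, `pullH_twoCocycleClass`;
  **`IsSES.pullH_δ₁` — naturality of the connecting homomorphism: `θ^*(δ₁ x) = δ₁(θ^* x)`**
  (on cocycles: the pull-back of a lift is a lift of the pull-back; the tree's `IsSES.res_δ₁` is
  the case of a subgroup inclusion) [Serre, *Galois Cohomology*, I §2.4; NSW (1.5.2)].
* §2 for the trivial modules `ℤ ⊆ ℚ ↠ ℚ/ℤ` (`ZCoeff`, `QCoeff`, `QModZCoeff`): restriction along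
  `θ` of a trivial module is the trivial module and of `trivialHom` is `trivialHom`
  (definitionally), so `pullH θ _ 2 ∘ δ = δ ∘ pullH θ _ 1` for the Bocksteins of `G` and `G'`
  (`pullH_δ₁_ZQ`); `IsSES.H2EquivOfDenseZpowers_δ₁_oneCocycleClass`,
  `H2IntEquivQModZ_δ₁_oneCocycleClass` — the invariant of `δ [χ]` is `χ(γ)`.
* §3 **the index formula** `H2IntEquivQModZ_pullH`: if `G ≅ Ẑ` is topologically generated by `γ`,
  `G' ≅ Ẑ` by `γ'`, and `θ(γ') = γ ^ m` (`m : ℤ`), then for every `c ∈ H²(G, ℤ)`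
  **`inv_{G',γ'}(θ^* c) = m · inv_{G,γ}(c)`** in `ℚ/ℤ`.  With `θ` the inclusion of the open
  subgroup of index `m` (generated by `γ^m`), or the map `Gal(E^nr/E) → Gal(F^nr/F)` of a finite
  extension of local fields (`Frob_E ↦ Frob_F^f`, `f` the residue degree), this is the
  group-cohomological half of "`inv_E ∘ res = [E:F] · inv_F`" (Serre, *Local Fields*, XIII §3
  Prop. 7; Cassels–Fröhlich VI §1.1 Prop. 1 / Thm. 2), i.e. of [AbsTopIII] Rmk. 1.10.1 (iii) /
  Rmk. 3.2.2 «compatibility, relative to dividing the `Ẑ` … by a factor given by the index of the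
  image of the induced open homomorphism» (abc-iut sub-DAG row P32.i.L07) — the other half being the
  valuation normalisation `v_E = e · v_F`.

Honest framing: textbook material; nothing here bears on abc or takes a side on [IUTchIII]
Cor. 3.12.

## References
* J.-P. Serre, *Local Fields* (1979), XIII §3 Prop. 7. [SerreLocalFields1979]
* J.-P. Serre, *Galois Cohomology* (1997), I §2.4. [SerreGaloisCohomology1997]
* J. W. S. Cassels, A. Fröhlich (eds.), *Algebraic Number Theory* (1967), Ch. VI §1.1.
  [CasselsFrohlichANT1967]
-/

noncomputable section

open CategoryTheory Function

universe u v

namespace Literature.NumberTheory.GaloisRepresentations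

open _root_.TopRep _root_.ContRepresentation _root_.ContinuousCohomology _root_.Topology

/-! ### §1 Pull-back of short exact sequences and naturality of `δ₁` -/

section Pull

variable {k : Type*} [CommRing k] [TopologicalSpace k]
variable {G : Type u} [Group G] [TopologicalSpace G] [IsTopologicalGroup G]
variable {G' : Type u} [Group G'] [TopologicalSpace G'] [IsTopologicalGroup G']
variable (θ : G' →ₜ* G)
variable {M : Type u} [AddCommGroup M] [Module k M] [TopologicalSpace M] [DiscreteTopology M]
  [ContinuousSMul k M]
variable {M' : Type u} [AddCommGroup M'] [Module k M'] [TopologicalSpace M'] [DiscreteTopology M']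
  [ContinuousSMul k M']

/-- A morphism of discrete `G`-modules as a morphism of the `G'`-modules obtained by restriction
along `θ : G' → G` (same underlying map; the tree's `resModHom` is the case of a subgroup
inclusion). [cite: SerreGaloisCohomology1997, I §2.4] -/
def pullHom {ρ : ContinuousRep G k M} {ρ' : ContinuousRep G k M'} (f : ρ.toTopRep ⟶ ρ'.toTopRep) :
    (ρ.restrict θ).toTopRep ⟶ (ρ'.restrict θ).toTopRep :=
  TopRep.ofHom ⟨f.hom.toContinuousLinearMap, fun g' => f.hom.isIntertwining' (θ g')⟩

omit [IsTopologicalGroup G] [IsTopologicalGroup G'] in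
/-- `pullHom θ f` is `f` on elements. [cite: SerreGaloisCohomology1997, I §2.4] -/
@[simp] theorem pullHom_hom_apply {ρ : ContinuousRep G k M} {ρ' : ContinuousRep G k M'}
    (f : ρ.toTopRep ⟶ ρ'.toTopRep) (m : M) : (pullHom θ f).hom m = f.hom m := rfl

/-- **`θ^* : Hⁿ(G, M) → Hⁿ(G', M|θ)`**, the pull-back on continuous cohomology along `θ` (Mathlib's
`ContinuousCohomology.map` along `θ` and the identity of the module; the tree's `resH` is the case of
a subgroup inclusion). [cite: SerreGaloisCohomology1997, I §2.4] -/
abbrev pullH (ρ : ContinuousRep G k M) (n : ℕ) :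
    continuousCohomology n ρ.toTopRep ⟶ continuousCohomology n (ρ.restrict θ).toTopRep :=
  ContinuousCohomology.map θ (𝟙 ((ρ.restrict θ).toTopRep)) n

/-- `θ^* [φ] = [φ ∘ θ]` in degree one. [cite: SerreGaloisCohomology1997, I §2.4] -/
theorem pullH_oneCocycleClass (ρ : ContinuousRep G k M) (φ : contOneCocycles ρ.toTopRep) :
    pullH θ ρ 1 (oneCocycleClass _ φ) =
      oneCocycleClass _ (contOneCocycles.pullback θ (𝟙 ((ρ.restrict θ).toTopRep)) φ) :=
  map_oneCocycleClass _ _ _ φ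

/-- `θ^* [c] = [c ∘ (θ × θ)]` in degree two. [cite: SerreGaloisCohomology1997, I §2.4] -/
theorem pullH_twoCocycleClass [LocallyCompactSpace G] [LocallyCompactSpace G']
    (ρ : ContinuousRep G k M) (c : contTwoCocycles ρ.toTopRep) :
    pullH θ ρ 2 (twoCocycleClass _ c) =
      twoCocycleClass _ (contTwoCocycles.pullback θ (𝟙 ((ρ.restrict θ).toTopRep)) c) :=
  map_twoCocycleClass _ _ _ c

variable {M₂ : Type u} [AddCommGroup M₂] [Module k M₂] [TopologicalSpace M₂] [DiscreteTopology M₂]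
  [ContinuousSMul k M₂]
variable {M₃ : Type u} [AddCommGroup M₃] [Module k M₃] [TopologicalSpace M₃] [DiscreteTopology M₃]
  [ContinuousSMul k M₃]
variable {ρ₁ : ContinuousRep G k M} {ρ₂ : ContinuousRep G k M₂} {ρ₃ : ContinuousRep G k M₃}
variable {f : ρ₁.toTopRep ⟶ ρ₂.toTopRep} {g : ρ₂.toTopRep ⟶ ρ₃.toTopRep}

omit [IsTopologicalGroup G] [IsTopologicalGroup G'] in
/-- A short exact sequence of discrete `G`-modules pulls back along `θ : G' → G` to a short exact
sequence of `G'`-modules. [cite: SerreGaloisCohomology1997, I §2.4] -/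
theorem IsSES.pull (h : IsSES f g) : IsSES (pullHom θ f) (pullHom θ g) :=
  ⟨by ext m; exact congr(($(h.comp_eq_zero)).hom m), h.injective, h.exact_mid, h.surjective⟩

/-- **Naturality of the connecting homomorphism under pull-back**: `θ^* (δ₁ x) = δ₁ (θ^* x)`
for the pulled-back short exact sequence (on cocycles: the pull-back `φ̃ ∘ θ` of a lift of `φ` is
a lift of `φ ∘ θ`, and `f⁻¹` is unchanged). [cite: SerreGaloisCohomology1997, I §2.4] -/
theorem IsSES.pullH_δ₁ [LocallyCompactSpace G] [LocallyCompactSpace G'] (h : IsSES f g)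
    (x : continuousCohomology 1 ρ₃.toTopRep) :
    pullH θ ρ₁ 2 (h.δ₁ x) = (h.pull θ).δ₁ (pullH θ ρ₃ 1 x) := by
  obtain ⟨φ, rfl⟩ := oneCocycleClass_surjective _ x
  rw [IsSES.δ₁_oneCocycleClass_eq_δ₁Aux, IsSES.δ₁Aux, pullH_twoCocycleClass,
    pullH_oneCocycleClass]
  -- the pulled-back lift
  let φt : C(G', M₂) := (h.liftCocycle φ).comp (θ : C(G', G))
  have hφt : ∀ σ τ : G', (pullHom θ g).hom (φt (σ * τ)) =
      (pullHom θ g).hom (φt σ) + (ρ₃.restrict θ) σ ((pullHom θ g).hom (φt τ)) := fun σ τ => by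
    change g.hom (h.liftCocycle φ (θ (σ * τ))) =
      g.hom (h.liftCocycle φ (θ σ)) + ρ₃ (θ σ) (g.hom (h.liftCocycle φ (θ τ)))
    rw [map_mul]
    exact h.liftCocycle_isLift φ (θ σ) (θ τ)
  have e : contOneCocycles.pullback θ (𝟙 ((ρ₃.restrict θ).toTopRep)) φ =
      IsSES.pushCocycle φt hφt :=
    Subtype.ext (ContinuousMap.ext fun σ => (h.g_liftCocycle_apply φ (θ σ)).symm)
  rw [e, IsSES.δ₁_oneCocycleClass]
  refine congrArg _ (Subtype.ext (ContinuousMap.ext fun q => ?_))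
  obtain ⟨σ, τ⟩ := q
  apply (h.pull θ).injective
  rw [(h.pull θ).f_connectingCocycle_apply]
  change f.hom ((h.connectingCocycle (h.liftCocycle φ) (h.liftCocycle_isLift φ)).1 (θ σ, θ τ)) =
    ρ₂ (θ σ) (h.liftCocycle φ (θ τ)) - h.liftCocycle φ (θ (σ * τ)) + h.liftCocycle φ (θ σ)
  rw [map_mul]
  exact h.f_connectingCocycle_apply _ _ _ _

end Pull

/-! ### §2 The trivial modules `ℤ ⊆ ℚ ↠ ℚ/ℤ`: pull-back and the invariant of a Bockstein -/

section TrivialPull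

variable {G : Type u} [Group G] [TopologicalSpace G] [IsTopologicalGroup G]
variable {G' : Type u} [Group G'] [TopologicalSpace G'] [IsTopologicalGroup G']
variable (θ : G' →ₜ* G)
variable {A : Type u} [AddCommGroup A] [TopologicalSpace A] [DiscreteTopology A]
variable {B : Type u} [AddCommGroup B] [TopologicalSpace B] [DiscreteTopology B]

omit [IsTopologicalGroup G] [IsTopologicalGroup G'] [DiscreteTopology A] in
/-- Restricting the TRIVIAL module along `θ` gives the trivial module (definitionally).
[cite: SerreGaloisCohomology1997, I §2.4] -/
theorem trivial_restrict : (ContinuousRep.trivial G ℤ A).restrict θ = ContinuousRep.trivial G' ℤ A :=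
  rfl

omit [IsTopologicalGroup G] [IsTopologicalGroup G'] in
/-- Pulling back `trivialHom G i` along `θ` gives `trivialHom G' i` (definitionally).
[cite: SerreGaloisCohomology1997, I §2.4] -/
theorem pullHom_trivialHom (i : A →+ B) : pullHom θ (trivialHom G i) = trivialHom G' i := rfl

omit [IsTopologicalGroup G] [IsTopologicalGroup G'] in
/-- The pulled-back character `(θ^* φ)(g') = φ(θ g')` for a trivial module.
[cite: SerreGaloisCohomology1997, I §2.4] -/
@[simp] theorem contOneCocycles.pullback_trivial_apply
    (φ : contOneCocycles (ContinuousRep.trivial G ℤ A).toTopRep) (g' : G') :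
    (contOneCocycles.pullback θ (𝟙 ((ContinuousRep.trivial G' ℤ A).toTopRep)) φ :
      contOneCocycles (ContinuousRep.trivial G' ℤ A).toTopRep).1 g' = φ.1 (θ g') :=
  rfl

/-- **Naturality of the Bockstein of `0 → ℤ → ℚ → ℚ/ℤ → 0` under pull-back**:
`θ^* (δ_G x) = δ_{G'} (θ^* x)`. [cite: SerreGaloisCohomology1997, I §2.4] -/
theorem pullH_δ₁_ZQ [LocallyCompactSpace G] [LocallyCompactSpace G']
    (x : continuousCohomology 1 (ContinuousRep.trivial G ℤ QModZCoeff.{u}).toTopRep) :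
    pullH θ (ContinuousRep.trivial G ℤ ZCoeff.{u}) 2 ((isSES_ZQ G).δ₁ x) =
      (isSES_ZQ G').δ₁ (pullH θ (ContinuousRep.trivial G ℤ QModZCoeff.{u}) 1 x) :=
  (isSES_ZQ G).pullH_δ₁ θ x

end TrivialPull

section Invariant

variable {G : Type u} [Group G] [TopologicalSpace G] [IsTopologicalGroup G] [CompactSpace G]
  [T2Space G] [TotallyDisconnectedSpace G]
variable {M₁ : Type u} [AddCommGroup M₁] [TopologicalSpace M₁] [DiscreteTopology M₁]
variable {M₂ : Type u} [AddCommGroup M₂] [TopologicalSpace M₂] [DiscreteTopology M₂]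
variable {M₃ : Type u} [AddCommGroup M₃] [TopologicalSpace M₃] [DiscreteTopology M₃]
variable {ρ₁ : ContinuousRep G ℤ M₁} {ρ₂ : ContinuousRep G ℤ M₂} {ρ₃ : ContinuousRep G ℤ M₃}
variable {f : ρ₁.toTopRep ⟶ ρ₂.toTopRep} {g : ρ₂.toTopRep ⟶ ρ₃.toTopRep}

/-- **The invariant of a Bockstein**: `H2EquivOfDenseZpowers (δ₁ [ψ]) = ψ(γ)` for every continuous
homomorphism `ψ : G → M₃`. [cite: SerreLocalFields1979, XIII §3] -/
theorem IsSES.H2EquivOfDenseZpowers_δ₁_oneCocycleClass (h : IsSES f g)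
    (hdiv : ∀ n : ℕ, 0 < n → Function.Bijective fun m : M₂ => (n : ℤ) • m)
    (htriv : ∀ (σ : G) (x : M₃), ρ₃ σ x = x) {γ : G}
    (hγ : Dense (Subgroup.zpowers γ : Set G))
    (hidx : ∀ n : ℕ, 0 < n → ∃ H : Subgroup G, IsOpen (H : Set G) ∧ H.index = n)
    (htors : ∀ x : M₃, IsOfFinAddOrder x) (ψ : contOneCocycles ρ₃.toTopRep) :
    h.H2EquivOfDenseZpowers hdiv htriv hγ hidx htors (h.δ₁ (oneCocycleClass _ ψ)) = ψ.1 γ := by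
  rw [← h.H2EquivOfDenseZpowers_symm_apply_eq hdiv htriv hγ hidx htors (ψ.1 γ) ψ rfl,
    LinearEquiv.apply_symm_apply]

/-- **The invariant of a Bockstein** (`ℤ ⊆ ℚ ↠ ℚ/ℤ`): `H2IntEquivQModZ (δ [χ]) = χ(γ)` for every
continuous character `χ : G → ℚ/ℤ`. [cite: SerreLocalFields1979, XIII §3] -/
theorem H2IntEquivQModZ_δ₁_oneCocycleClass {γ : G} (hγ : Dense (Subgroup.zpowers γ : Set G))
    (hidx : ∀ n : ℕ, 0 < n → ∃ H : Subgroup G, IsOpen (H : Set G) ∧ H.index = n)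
    (χ : contOneCocycles (ContinuousRep.trivial G ℤ QModZCoeff.{u}).toTopRep) :
    H2IntEquivQModZ hγ hidx ((isSES_ZQ G).δ₁ (oneCocycleClass _ χ)) = χ.1 γ :=
  (isSES_ZQ G).H2EquivOfDenseZpowers_δ₁_oneCocycleClass QCoeff.bijective_smul (fun _ _ => rfl)
    hγ hidx QModZCoeff.isOfFinAddOrder χ

/-- Every class of `H²(G, ℤ)` is the Bockstein of a continuous character: `c = δ [H2IntEquivHom G c]`.
[cite: SerreLocalFields1979, XIII §1] -/
theorem δ₁_H2IntEquivHom
    (c : continuousCohomology 2 (ContinuousRep.trivial G ℤ ZCoeff.{u}).toTopRep) :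
    (isSES_ZQ G).δ₁ (oneCocycleClass _ (H2IntEquivHom G c)) = c :=
  (isSES_ZQ G).δ₁_oneCocycleClass_H2EquivContOneCocycles_apply QCoeff.bijective_smul
    (fun _ _ => rfl) c

end Invariant

/-! ### §3 The index formula -/

section Index

variable {G : Type u} [Group G] [TopologicalSpace G] [IsTopologicalGroup G] [CompactSpace G]
  [T2Space G] [TotallyDisconnectedSpace G]
variable {G' : Type u} [Group G'] [TopologicalSpace G'] [IsTopologicalGroup G'] [CompactSpace G']
  [T2Space G'] [TotallyDisconnectedSpace G']

/-- **The index formula.**  Let `G ≅ Ẑ` be topologically generated by `γ` and `G' ≅ Ẑ` by `γ'`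
(profinite, dense cyclic subgroups, an open subgroup of every positive index), and let
`θ : G' → G` be a continuous homomorphism with `θ(γ') = γ ^ m`.  Then for every `c ∈ H²(G, ℤ)`,
`inv_{G',γ'}(θ^* c) = m • inv_{G,γ}(c)` in `ℚ/ℤ` (`c = δ[χ]`, `θ^* c = δ[χ ∘ θ]`,
`(χ ∘ θ)(γ') = χ(γ^m) = m χ(γ)`).  Cases: `θ` the inclusion of the open subgroup of index `m`
(`cor∘res`-free form of "`res` multiplies invariants by the index"), or
`Gal(E^nr/E) → Gal(F^nr/F)`, `Frob_E ↦ Frob_F^f` — the cohomological half of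
`inv_E ∘ res_{E/F} = [E:F] · inv_F`. [cite: SerreLocalFields1979, XIII §3 Prop. 7] -/
theorem H2IntEquivQModZ_pullH (θ : G' →ₜ* G) {γ : G} {γ' : G'} {m : ℤ} (hθ : θ γ' = γ ^ m)
    (hγ : Dense (Subgroup.zpowers γ : Set G))
    (hidx : ∀ n : ℕ, 0 < n → ∃ H : Subgroup G, IsOpen (H : Set G) ∧ H.index = n)
    (hγ' : Dense (Subgroup.zpowers γ' : Set G'))
    (hidx' : ∀ n : ℕ, 0 < n → ∃ H : Subgroup G', IsOpen (H : Set G') ∧ H.index = n)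
    (c : continuousCohomology 2 (ContinuousRep.trivial G ℤ ZCoeff.{u}).toTopRep) :
    H2IntEquivQModZ hγ' hidx' (pullH θ (ContinuousRep.trivial G ℤ ZCoeff.{u}) 2 c) =
      m • H2IntEquivQModZ hγ hidx c := by
  -- write `c = δ [χ]`
  set χ := H2IntEquivHom G c with hχ
  have hc : c = (isSES_ZQ G).δ₁ (oneCocycleClass _ χ) := (δ₁_H2IntEquivHom c).symm
  have hinv : H2IntEquivQModZ hγ hidx c = χ.1 γ := by
    rw [hc, H2IntEquivQModZ_δ₁_oneCocycleClass]
  rw [hinv, hc, pullH_δ₁_ZQ, pullH_oneCocycleClass]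
  -- `(trivial G).restrict θ` is the trivial module of `G'` (definitionally)
  change H2IntEquivQModZ hγ' hidx' ((isSES_ZQ G').δ₁ (oneCocycleClass
      (ContinuousRep.trivial G' ℤ QModZCoeff.{u}).toTopRep
      (contOneCocycles.pullback θ (𝟙 ((ContinuousRep.trivial G' ℤ QModZCoeff.{u}).toTopRep)) χ))) =
    m • χ.1 γ
  rw [H2IntEquivQModZ_δ₁_oneCocycleClass, contOneCocycles.pullback_trivial_apply, hθ,
    contOneCocycles.apply_zpow_of_trivial (fun _ _ => rfl)]

/-- The index formula for a natural-number exponent: `θ(γ') = γ ^ m` with `m : ℕ`.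
[cite: SerreLocalFields1979, XIII §3 Prop. 7] -/
theorem H2IntEquivQModZ_pullH_of_pow_eq (θ : G' →ₜ* G) {γ : G} {γ' : G'} {m : ℕ}
    (hθ : θ γ' = γ ^ m)
    (hγ : Dense (Subgroup.zpowers γ : Set G))
    (hidx : ∀ n : ℕ, 0 < n → ∃ H : Subgroup G, IsOpen (H : Set G) ∧ H.index = n)
    (hγ' : Dense (Subgroup.zpowers γ' : Set G'))
    (hidx' : ∀ n : ℕ, 0 < n → ∃ H : Subgroup G', IsOpen (H : Set G') ∧ H.index = n)
    (c : continuousCohomology 2 (ContinuousRep.trivial G ℤ ZCoeff.{u}).toTopRep) :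
    H2IntEquivQModZ hγ' hidx' (pullH θ (ContinuousRep.trivial G ℤ ZCoeff.{u}) 2 c) =
      m • H2IntEquivQModZ hγ hidx c := by
  rw [← natCast_zsmul]
  exact H2IntEquivQModZ_pullH θ (m := (m : ℤ)) (by rw [hθ, zpow_natCast]) hγ hidx hγ' hidx' c

/-- **Invariance under topological isomorphisms preserving the generator**: if `θ : G' → G`
sends `γ'` to `γ`, then `inv_{G',γ'}(θ^* c) = inv_{G,γ}(c)`. [cite: SerreLocalFields1979, XIII §3] -/
theorem H2IntEquivQModZ_pullH_of_eq (θ : G' →ₜ* G) {γ : G} {γ' : G'} (hθ : θ γ' = γ)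
    (hγ : Dense (Subgroup.zpowers γ : Set G))
    (hidx : ∀ n : ℕ, 0 < n → ∃ H : Subgroup G, IsOpen (H : Set G) ∧ H.index = n)
    (hγ' : Dense (Subgroup.zpowers γ' : Set G'))
    (hidx' : ∀ n : ℕ, 0 < n → ∃ H : Subgroup G', IsOpen (H : Set G') ∧ H.index = n)
    (c : continuousCohomology 2 (ContinuousRep.trivial G ℤ ZCoeff.{u}).toTopRep) :
    H2IntEquivQModZ hγ' hidx' (pullH θ (ContinuousRep.trivial G ℤ ZCoeff.{u}) 2 c) =
      H2IntEquivQModZ hγ hidx c := by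
  rw [H2IntEquivQModZ_pullH_of_pow_eq θ (m := 1) (by rw [hθ, pow_one]) hγ hidx hγ' hidx' c,
    one_smul]

end Index

end Literature.NumberTheory.GaloisRepresentations

end
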